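import Literature.MathematicalPhysics.QuantumFieldTheory.Balaban1983to89.B8Ineq159StencilsNearFlat

/-!
# `Balaban1983to89.B8Ineq159TowerNearFlat` — [Balaban1985BackgroundPropagators] (3.19) p. 393, (3.24) p. 394 ∕ [Balaban1985Averaging] (43) p. 24,
# (78)–(80) p. 30, (122)–(127) pp. 36–37: THE AVERAGING TOWER OF THE (1.59) DATA NEAR FLAT — the transpose `Q′(U₀)ᵀ` at every truncation `m` and the
# linearised averages `LʲQ_j(U₀)` at every level `j ≤ m` against the flat ones, given that the averaged backgrounds `Ū₀ⁱ` (`i < m`) are unit-bounded and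
# `ε̄`-close to `1` (file (C′) of the per-member curved (1.59); the tower companion of `B8Ineq159StencilsNearFlat` §2–§3)

statement-level skeleton of published theorems with citation tags; proofs where landed; nothing here is a claim about the
Yang–Mills mass gap

[4] = `[Balaban1985BackgroundPropagators]` (CMP **99** (1985) 389–434) (3.19) p. 393, (3.24) p. 394, (3.79) p. 406; [B7] = `[Balaban1985Averaging]` (CMP **98**
(1985) 17–51) (43) p. 24, (78)–(80) p. 30, (122)–(127) pp. 36–37; `[Balaban1985RegularSpaces]` ("B8") (1.29) p. 81, (1.31) p. 82, (1.38) p. 82, (1.59) p. 86.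

CITATION HEADER (lean-in-tree rule).  Cell `pub-ymgap` (YM Track A, HUMAN RULING D-0062 ∕ D-0149), DAG node N05 = [B8], width seat `pub-ymgap-dag-n05-w3`
(g2), CLAIM-1 file (C′).  WHY.  File (D) (`B8Ineq159CurvedCubeMemberPerCube`, truncation `m = 1`) used the ONE-STEP transpose and average of
`B8Ineq159StencilsNearFlat` §2–§3.  At truncation `m ≥ 2` the transpose `Q′(U₀)ᵀ = Σ_j Q′_j(U₀)ᵀ` and the averages `Q_j(U₀)` iterate through the averaged
backgrounds `Ū₀ⁱ = avgIter L U₀ i` ([B7] (43)), whose block transporters `Ū₀ⁱ(Γ_{Ly,x})` enter `Q′(U₀)ᵀ` ((1.29) ∕ [4] (3.19)) and whose one-step linearisations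
`L(Q(Ū₀ⁱ)·)` compose to `LʲQ_j(U₀)` ([B7] (127)).  THIS FILE runs the two inductions with the per-level smallness DISPLAYED (`Ū₀ⁱ(b) ∈ U1`,
`‖Ū₀ⁱ(b) − 1‖ ≤ ε̄`, `i < m`) — discharged in file (D′) from [B7] Prop. 2's averaging-closed regime (`B7Prop2Explicit.avgIter_mem`,
`B7Eq43AveragedSmallness.norm_avgIter_sub_one_le`).

THE MATHEMATICS (kernel-checked; `L ≥ 1`, `ε̄ ≥ 0`).
* §1 the transpose tower: `‖Ū₀ⁱ(Γ_{Ly,x}) − 1‖ ≤ dLε̄`; one step `‖(Q′ᵀν)ᵢ − (Q′(1)ᵀν)ᵢ‖ ≤ L^{−d}·2dLε̄·‖ν‖`, `‖(Q′ᵀν)ᵢ‖ ≤ L^{−d}‖ν‖`; ★ `norm_QprimeT_sub_flat_le` —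
  `‖Q′_j(U₀)ᵀν − Q′_j(1)ᵀν‖ ≤ j·2dLε̄·L^{−jd}·‖ν‖∞` (`j ≤ m`; telescoping through the `j` steps); ★ `norm_QT_sub_flat_le` — at truncation `m`,
  `‖Q′(U₀)ᵀμ − Q′(1)ᵀμ‖ ≤ m(m+1)·2dLε̄·sup‖μ‖` over the restriction sets.
* §2 the averaging tower: ★ `norm_linCovIter_sub_flat_le` — for `128(d+1)²Lε̄ ≤ 1` and `‖B‖ ≤ b`, `‖LʲQ_j(U₀)B − LʲQ_j(1)B‖ ≤ j·102(d+1)²Lε̄·(2L)ʲ·b` together with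
  `‖LʲQ_j(U₀)B‖ ≤ (2L)ʲb` (`j ≤ m`; induction: at each step [B7] (126)'s Lipschitz modulus at `V₀ = 1`, `B9Eq315QLipschitz.norm_linQcov_sub_flat_le_of_bonds`, plus the
  flat step `‖L(Q₀X)‖ ≤ L‖X‖∞`, `B7Prop4Flat.norm_linQ_le_of_bound`).

HONEST SCOPE.  Elementary inductions with crude explicit constants (exponential in the level — print's (52)–(54) keep `α₀L^{−2}`-scaled regularity level by
level, sharper, NOT this); the per-level smallness of the averaged backgrounds is a displayed HYPOTHESIS here; nothing of [4] Thm 3.3; count-neutral; N05 NOT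
discharged; no count claim; one finite `𝕋⁴` programme at fixed `ε`, Bałaban as printed; the YM mass gap (Clay) is NOT proved by any of this — R4 closes the
conditional finite-`𝕋⁴` rung `BalabanLadder.UV` only; nothing continuum ∕ ℝ⁴ ∕ OS.  No `sorry`, no `def`, no `instance`, no `notation`.  Unit
`pub-ymgap-dag-n05-w3` (g2), 2026-08-28.
-/

noncomputable section

namespace Literature.MathematicalPhysics.QuantumFieldTheory.Balaban1983to89.B8Ineq159TowerNearFlat

open B7Prop1Explicit B7Prop2Explicit B7Prop1Local
open B7Eq78Linearization (conjR conjR_apply)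
open B7Prop4GeneralLevels (linCovIter linCovIter_succ linCovIter_zero)
open B7Prop3GeneralLinear (linQcov linQcov_one_left)
open B7Prop3GeneralRotated (norm_conjR_le)
open B7Prop3Flat (linQ)
open B7Prop4Flat (linQIter linQIter_succ linQ_sub norm_linQIter_le norm_linQ_le_of_bound)
open B9Eq316TowerFlatIsOneStep (linCovIter_one_left)
open B8Eq143PlaqExpansion (norm_conjR_sub_self_le)
open B8Eq138LandauZd (qprimeT1 QprimeT QT)
open B8Eq119TwistedAxial (bgT bgT_one)
open B8Eq191FlatStencils (qprimeT1_flat_apply QprimeT_flat_apply)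
open B9Eq315QLipschitz (norm_hol_sub_one_le norm_Wcx_sub_one_le norm_linQcov_sub_flat_le_of_bonds)
open B8Ineq159StencilsNearFlat (l1_sub_blockBase_blockMap_le)
open Literature.MathematicalPhysics.QuantumLattice (blockMap blockBase)
open B7BlockGeometry (blockMap_blockMap)

export B7Prop1Explicit (Site)

variable {d : ℕ} {𝔸 : Type*} [NormedRing 𝔸] [NormOneClass 𝔸] [NormedAlgebra ℂ 𝔸] [CompleteSpace 𝔸]

variable {L : ℕ} (hL : 1 ≤ L) {U₀ : Site d → Fin d → 𝔸ˣ} {m : ℕ} {εb : ℝ} (hε0 : 0 ≤ εb)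
  (hUi : ∀ i, i < m → ∀ (x : Site d) (κ : Fin d), avgIter L U₀ i x κ ∈ U1 𝔸)
  (hεi : ∀ i, i < m → ∀ (x : Site d) (κ : Fin d), ‖((avgIter L U₀ i x κ : 𝔸ˣ) : 𝔸) - 1‖ ≤ εb)

/-! ## §1 The transpose tower `Q′(U₀)ᵀ` near flat -/

section Transpose

include hL hε0 hUi hεi in
/-- **The level-`i` block transporter near flat** (`i < m`): `‖Ū₀ⁱ(Γ_{Ly,x}) − 1‖ ≤ dL·ε̄` (`|Γ| ≤ dL` bonds of `Ū₀ⁱ`, each `ε̄`-close to `1`).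
[cite: Balaban1985Averaging, (78)–(80) p.30, (43) p.24; Balaban1985RegularSpaces, (1.29) p.81] -/
theorem norm_bgT_sub_one_le {i : ℕ} (hi : i < m) (x : Site d) :
    ‖((bgT L U₀ i (blockMap L x) x : 𝔸ˣ) : 𝔸) - 1‖ ≤ d * L * εb := by
  unfold bgT axialFn
  refine (norm_hol_sub_one_le (hUi i hi) (hεi i hi) _ _).trans ?_
  rw [length_treeWord]
  exact mul_le_mul_of_nonneg_right (by exact_mod_cast l1_sub_blockBase_blockMap_le hL x) hε0

include hL hε0 hUi hεi in
/-- **One step of the transpose at level `i < m` near flat**: `‖(Q′(U₀)ᵀν)ᵢ(x) − (Q′(1)ᵀν)ᵢ(x)‖ ≤ L^{−d}·2dLε̄·‖ν(y(x))‖`.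
[cite: Balaban1985BackgroundPropagators, (3.19) p.393, (3.24) p.394; Balaban1985Averaging, (56) p.27] -/
theorem norm_qprimeT1_sub_flat_le {i : ℕ} (hi : i < m) (ν : Site d → 𝔸) (x : Site d) :
    ‖qprimeT1 L U₀ i ν x - qprimeT1 L (1 : Site d → Fin d → 𝔸ˣ) i ν x‖ ≤ ((L : ℝ) ^ d)⁻¹ * (2 * (d * L * εb) * ‖ν (blockMap L x)‖) := by
  rw [qprimeT1_flat_apply]
  unfold qprimeT1
  rw [← smul_sub, norm_smul, Real.norm_of_nonneg (by positivity)]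
  refine mul_le_mul_of_nonneg_left ?_ (by positivity)
  set u : 𝔸ˣ := bgT L U₀ i (blockMap L x) x with hu
  have hu1 : u ∈ U1 𝔸 := by
    rw [hu]; unfold bgT axialFn; exact hol_mem (hUi i hi) _ _
  have hinv : ‖((u⁻¹ : 𝔸ˣ) : 𝔸) - 1‖ ≤ d * L * εb := (norm_inv_sub_one_le hu1).trans (norm_bgT_sub_one_le hL hε0 hUi hεi hi x)
  exact (norm_conjR_sub_self_le ((U1 𝔸).inv_mem hu1) _).trans (by gcongr)

include hUi in
/-- One step of the transpose contracts: `‖(Q′(U₀)ᵀν)ᵢ(x)‖ ≤ L^{−d}‖ν(y(x))‖` (`R(u)` is a contraction on `U1`). [cite: Balaban1985BackgroundPropagators, (3.19) p.393] -/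
theorem norm_qprimeT1_le {i : ℕ} (hi : i < m) (ν : Site d → 𝔸) (x : Site d) :
    ‖qprimeT1 L U₀ i ν x‖ ≤ ((L : ℝ) ^ d)⁻¹ * ‖ν (blockMap L x)‖ := by
  unfold qprimeT1
  rw [norm_smul, Real.norm_of_nonneg (by positivity)]
  refine mul_le_mul_of_nonneg_left (norm_conjR_le ((U1 𝔸).inv_mem ?_) _) (by positivity)
  unfold bgT axialFn; exact hol_mem (hUi i hi) _ _

include hL hε0 hUi hεi in
/-- ★ **THE LEVEL-`j` TRANSPOSE NEAR FLAT** (`j ≤ m`): `‖(Q′_j(U₀)ᵀν)(x) − (Q′_j(1)ᵀν)(x)‖ ≤ j·2dLε̄·L^{−jd}·M` for `‖ν‖ ≤ M` — telescoping through the `j`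
one-step transposes (each flat step is `L^{−d}`-homogeneous, each curved step contracts). [cite: Balaban1985BackgroundPropagators, (3.19) p.393, (3.24) p.394; Balaban1985Averaging, (43) p.24] -/
theorem norm_QprimeT_sub_flat_le :
    ∀ j, j ≤ m → ∀ (ν : Site d → 𝔸) (M : ℝ), (∀ y, ‖ν y‖ ≤ M) → ∀ x : Site d,
      ‖QprimeT L U₀ j ν x - QprimeT L (1 : Site d → Fin d → 𝔸ˣ) j ν x‖ ≤ j * (2 * (d * L * εb)) * (((L : ℝ) ^ d)⁻¹) ^ j * M
  | 0, _, ν, M, hM, x => by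
    show ‖ν x - ν x‖ ≤ _
    simp
  | j + 1, hj, ν, M, hM, x => by
    have hjm : j < m := Nat.lt_of_succ_le hj
    have hM0 : 0 ≤ M := (norm_nonneg _).trans (hM x)
    -- `Q′_{j+1}ᵀν = Q′_jᵀ(q_jν)` at both backgrounds
    show ‖QprimeT L U₀ j (qprimeT1 L U₀ j ν) x - QprimeT L (1 : Site d → Fin d → 𝔸ˣ) j (qprimeT1 L 1 j ν) x‖ ≤ _
    have hq : ∀ y, ‖qprimeT1 L U₀ j ν y‖ ≤ ((L : ℝ) ^ d)⁻¹ * M :=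
      fun y => (norm_qprimeT1_le hUi hjm ν y).trans (by gcongr; exact hM _)
    have h1 := norm_QprimeT_sub_flat_le j hjm.le (qprimeT1 L U₀ j ν) (((L : ℝ) ^ d)⁻¹ * M) hq x
    have h2 : ‖QprimeT L (1 : Site d → Fin d → 𝔸ˣ) j (qprimeT1 L U₀ j ν) x - QprimeT L (1 : Site d → Fin d → 𝔸ˣ) j (qprimeT1 L 1 j ν) x‖
        ≤ (((L : ℝ) ^ d)⁻¹) ^ j * (((L : ℝ) ^ d)⁻¹ * (2 * (d * L * εb) * M)) := by
      rw [QprimeT_flat_apply, QprimeT_flat_apply, ← smul_sub, norm_smul, Real.norm_of_nonneg (by positivity)]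
      refine mul_le_mul_of_nonneg_left ?_ (by positivity)
      exact (norm_qprimeT1_sub_flat_le hL hε0 hUi hεi hjm ν _).trans (by gcongr; exact hM _)
    calc ‖QprimeT L U₀ j (qprimeT1 L U₀ j ν) x - QprimeT L (1 : Site d → Fin d → 𝔸ˣ) j (qprimeT1 L 1 j ν) x‖
        ≤ ‖QprimeT L U₀ j (qprimeT1 L U₀ j ν) x - QprimeT L (1 : Site d → Fin d → 𝔸ˣ) j (qprimeT1 L U₀ j ν) x‖
          + ‖QprimeT L (1 : Site d → Fin d → 𝔸ˣ) j (qprimeT1 L U₀ j ν) x - QprimeT L (1 : Site d → Fin d → 𝔸ˣ) j (qprimeT1 L 1 j ν) x‖ :=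
          norm_sub_le_norm_sub_add_norm_sub _ _ _
      _ ≤ j * (2 * (d * L * εb)) * (((L : ℝ) ^ d)⁻¹) ^ j * (((L : ℝ) ^ d)⁻¹ * M)
          + (((L : ℝ) ^ d)⁻¹) ^ j * (((L : ℝ) ^ d)⁻¹ * (2 * (d * L * εb) * M)) := add_le_add h1 h2
      _ = ((j + 1 : ℕ) : ℝ) * (2 * (d * L * εb)) * (((L : ℝ) ^ d)⁻¹) ^ (j + 1) * M := by push_cast; ring

include hL hε0 hUi hεi in
/-- ★ **THE TRANSPOSE `Q′(U₀)ᵀ` AT TRUNCATION `m` NEAR FLAT**: `‖(Q′(U₀)ᵀμ)(x) − (Q′(1)ᵀμ)(x)‖ ≤ m(m+1)·2dL·ε̄·M` whenever `‖μ_j‖ ≤ M` on `Λ_j`, `j ≤ m` (the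
level-`j` summand costs `j·2dLε̄·L^{−jd}·M ≤ m·2dLε̄·M`, `m + 1` summands). [cite: Balaban1985BackgroundPropagators, (3.24) p.394, (3.19) p.393; Balaban1985RegularSpaces, (1.29) p.81, (1.38) p.82] -/
theorem norm_QT_sub_flat_le (Λs : ℕ → Set (Site d)) (μ : ℕ → Site d → 𝔸) {M : ℝ} (hM : 0 ≤ M)
    (hμ : ∀ j, j ≤ m → ∀ y ∈ Λs j, ‖μ j y‖ ≤ M) (x : Site d) :
    ‖QT L m Λs U₀ μ x - QT L m Λs (1 : Site d → Fin d → 𝔸ˣ) μ x‖ ≤ (m : ℝ) * (m + 1) * (2 * (d * L * εb)) * M := by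
  classical
  have hL1 : (1 : ℝ) ≤ (L : ℝ) ^ d := one_le_pow₀ (by exact_mod_cast hL)
  have hLd : ((L : ℝ) ^ d)⁻¹ ≤ 1 := inv_le_one_of_one_le₀ hL1
  unfold QT
  rw [← Finset.sum_sub_distrib]
  refine (norm_sum_le _ _).trans ?_
  have hterm : ∀ j ∈ Finset.range (m + 1),
      ‖QprimeT L U₀ j ((Λs j).indicator (μ j)) x - QprimeT L (1 : Site d → Fin d → 𝔸ˣ) j ((Λs j).indicator (μ j)) x‖ ≤
        (m : ℝ) * (2 * (d * L * εb)) * M := by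
    intro j hj
    have hjm : j ≤ m := Nat.lt_succ_iff.mp (Finset.mem_range.mp hj)
    have hind : ∀ y, ‖(Λs j).indicator (μ j) y‖ ≤ M := by
      intro y
      by_cases hy : y ∈ Λs j
      · rw [Set.indicator_of_mem hy]; exact hμ j hjm y hy
      · rw [Set.indicator_of_notMem hy, norm_zero]; exact hM
    refine (norm_QprimeT_sub_flat_le hL hε0 hUi hεi j hjm _ M hind x).trans ?_
    have hpow : (((L : ℝ) ^ d)⁻¹) ^ j ≤ 1 := pow_le_one₀ (by positivity) hLd
    have hj' : (j : ℝ) ≤ m := by exact_mod_cast hjm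
    calc (j : ℝ) * (2 * (d * L * εb)) * (((L : ℝ) ^ d)⁻¹) ^ j * M ≤ (m : ℝ) * (2 * (d * L * εb)) * 1 * M := by gcongr
      _ = (m : ℝ) * (2 * (d * L * εb)) * M := by ring
  refine (Finset.sum_le_sum hterm).trans ?_
  rw [Finset.sum_const, Finset.card_range, nsmul_eq_mul]
  push_cast
  exact le_of_eq (by ring)

end Transpose

/-! ## §2 The averaging tower `LʲQ_j(U₀)` near flat -/

section Average

include hL hε0 hUi hεi in
/-- ★ **THE LINEARISED AVERAGES `LʲQ_j(U₀)` NEAR FLAT, ALL LEVELS `j ≤ m`**: for `128(d+1)²Lε̄ ≤ 1` and `‖B‖ ≤ b`, simultaneously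
`‖LʲQ_j(U₀)B(c)‖ ≤ (2L)ʲb` and `‖LʲQ_j(U₀)B(c) − LʲQ_j(1)B(c)‖ ≤ j·102(d+1)²Lε̄·(2L)ʲ·b` — induction on [B7] (127): the step at background `Ū₀ʲ` differs from the flat
step by (126)'s modulus `102(d+1)²L·ε̄·L·‖X‖∞` (`B9Eq315QLipschitz.norm_linQcov_sub_flat_le_of_bonds`, block loops `2(d+1)Lε̄ ≤ 1∕64`-regular by `norm_Wcx_sub_one_le`), the
flat step is `L`-Lipschitz in sup norm (`B7Prop4Flat.norm_linQ_le_of_bound`). [cite: Balaban1985Averaging, (122)–(127) pp.36–37, (43) p.24; Balaban1985BackgroundPropagators, (3.79) p.406, (3.15) p.393; Balaban1985RegularSpaces, (1.31) p.82] -/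
theorem norm_linCovIter_sub_flat_le (hsmall : 128 * ((d : ℝ) + 1) ^ 2 * L * εb ≤ 1) {B : Site d → Fin d → 𝔸} {b : ℝ} (hb : 0 ≤ b)
    (hB : ∀ z κ, ‖B z κ‖ ≤ b) :
    ∀ j, j ≤ m → (∀ (z : Site d) (κ : Fin d), ‖linCovIter L U₀ B j z κ‖ ≤ (2 * (L : ℝ)) ^ j * b) ∧
      ∀ (z : Site d) (κ : Fin d), ‖linCovIter L U₀ B j z κ - linCovIter L (1 : Site d → Fin d → 𝔸ˣ) B j z κ‖ ≤
        j * (102 * ((d : ℝ) + 1) ^ 2 * L * εb) * (2 * (L : ℝ)) ^ j * b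
  | 0, _ => ⟨fun z κ => by simpa using hB z κ, fun z κ => by simp⟩
  | j + 1, hj => by
    have hjm : j < m := Nat.lt_of_succ_le hj
    obtain ⟨hXb, hXd⟩ := norm_linCovIter_sub_flat_le hsmall hb hB j hjm.le
    have hL0 : (0 : ℝ) < L := by exact_mod_cast hL
    have hd : (0 : ℝ) ≤ d := Nat.cast_nonneg d
    have hd1 : (1 : ℝ) ≤ (d : ℝ) + 1 := by linarith
    -- smallness at one step: loops `2(d+1)Lε̄ ≤ 1/64`, modulus `θ = 102(d+1)²Lε̄ ≤ 1`
    have h128 : 128 * ((d : ℝ) + 1) * L * εb ≤ 1 := by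
      have : 128 * ((d : ℝ) + 1) * L * εb ≤ 128 * ((d : ℝ) + 1) ^ 2 * L * εb := by
        have h0 : 0 ≤ 128 * ((d : ℝ) + 1) * L * εb := by positivity
        nlinarith
      linarith
    have hθ1 : 102 * ((d : ℝ) + 1) ^ 2 * L * εb ≤ 1 := by nlinarith [show (0:ℝ) ≤ ((d : ℝ) + 1) ^ 2 * L * εb by positivity]
    have hα : 2 * ((d : ℝ) + 1) * L * εb ≤ 1 / 64 := by nlinarith [show (0:ℝ) ≤ ((d : ℝ) + 1) * L * εb by positivity]
    set xj : ℝ := (2 * (L : ℝ)) ^ j * b with hxj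
    have hxj0 : 0 ≤ xj := by positivity
    -- the level-`j` fields
    set XU : Site d → Fin d → 𝔸 := linCovIter L U₀ B j with hXU
    set X1 : Site d → Fin d → 𝔸 := linCovIter L (1 : Site d → Fin d → 𝔸ˣ) B j with hX1
    have hX1eq : X1 = linQIter L B j := by rw [hX1]; exact linCovIter_one_left L hL B hb hB j
    have hX1b : ∀ z κ, ‖X1 z κ‖ ≤ (L : ℝ) ^ j * b := fun z κ => by rw [hX1eq]; exact norm_linQIter_le L hL B hb hB j z κ
    -- one step at background `Ū₀ʲ`
    have hstep : ∀ (z : Site d) (κ : Fin d),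
        ‖linQcov L (avgIter L U₀ j) XU ((L : ℤ) • z) κ - linQ L XU ((L : ℤ) • z) κ‖ ≤ 102 * ((d : ℝ) + 1) ^ 2 * L * εb * (L * xj) := by
      intro z κ
      have hW : ∀ r : Fin d → Fin L, ‖((Wcx L (avgIter L U₀ j) ((L : ℤ) • z) κ (boxVec L r) : 𝔸ˣ) : 𝔸) - 1‖ ≤ 2 * (d + 1) * L * εb :=
        fun r => norm_Wcx_sub_one_le (hUi j hjm) (hεi j hjm) L _ κ r hε0
      have h := norm_linQcov_sub_flat_le_of_bonds L (hUi j hjm) (hεi j hjm) hxj0 hXb hL ((L : ℤ) • z) κ hα hW hε0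
      rwa [linQcov_one_left L hL XU hxj0 hXb] at h
    have hflat : ∀ (z : Site d) (κ : Fin d), ‖linQ L XU ((L : ℤ) • z) κ‖ ≤ L * xj :=
      fun z κ => norm_linQ_le_of_bound XU hxj0 hXb L hL _ κ
    have hflatd : ∀ (z : Site d) (κ : Fin d), ‖linQ L XU ((L : ℤ) • z) κ - linQ L X1 ((L : ℤ) • z) κ‖ ≤
        L * (j * (102 * ((d : ℝ) + 1) ^ 2 * L * εb) * (2 * (L : ℝ)) ^ j * b) := by
      intro z κ
      rw [← linQ_sub]
      exact norm_linQ_le_of_bound (XU - X1) (by positivity) (fun w ν => by rw [Pi.sub_apply, Pi.sub_apply]; exact hXd w ν) L hL _ κ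
    refine ⟨fun z κ => ?_, fun z κ => ?_⟩
    · -- `‖X_{j+1}‖ ≤ θ·L·x_j + L·x_j ≤ 2L·x_j`
      rw [linCovIter_succ]
      calc ‖linQcov L (avgIter L U₀ j) XU ((L : ℤ) • z) κ‖
          ≤ ‖linQ L XU ((L : ℤ) • z) κ‖ + ‖linQcov L (avgIter L U₀ j) XU ((L : ℤ) • z) κ - linQ L XU ((L : ℤ) • z) κ‖ := norm_le_insert' _ _
        _ ≤ L * xj + 102 * ((d : ℝ) + 1) ^ 2 * L * εb * (L * xj) := add_le_add (hflat z κ) (hstep z κ)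
        _ ≤ L * xj + 1 * (L * xj) := by gcongr
        _ = (2 * (L : ℝ)) ^ (j + 1) * b := by rw [hxj]; ring
    · -- `‖X_{j+1} − Y_{j+1}‖ ≤ θL·x_j + L·D_j`
      rw [linCovIter_succ, linCovIter_succ, B7Eq92Concrete.avgIter_one]
      have hY : linQcov L (1 : Site d → Fin d → 𝔸ˣ) X1 ((L : ℤ) • z) κ = linQ L X1 ((L : ℤ) • z) κ :=
        linQcov_one_left L hL X1 (by positivity) hX1b _ κ
      rw [hY]
      calc ‖linQcov L (avgIter L U₀ j) XU ((L : ℤ) • z) κ - linQ L X1 ((L : ℤ) • z) κ‖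
          ≤ ‖linQcov L (avgIter L U₀ j) XU ((L : ℤ) • z) κ - linQ L XU ((L : ℤ) • z) κ‖
            + ‖linQ L XU ((L : ℤ) • z) κ - linQ L X1 ((L : ℤ) • z) κ‖ := norm_sub_le_norm_sub_add_norm_sub _ _ _
        _ ≤ 102 * ((d : ℝ) + 1) ^ 2 * L * εb * (L * xj) + L * (j * (102 * ((d : ℝ) + 1) ^ 2 * L * εb) * (2 * (L : ℝ)) ^ j * b) :=
            add_le_add (hstep z κ) (hflatd z κ)
        _ = (102 * ((d : ℝ) + 1) ^ 2 * L * εb) * (2 * (L : ℝ)) ^ j * b * (L * (1 + j)) := by rw [hxj]; ring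
        _ ≤ (102 * ((d : ℝ) + 1) ^ 2 * L * εb) * (2 * (L : ℝ)) ^ j * b * (2 * L * (j + 1)) := by
            refine mul_le_mul_of_nonneg_left ?_ (by positivity)
            have hj0 : (0 : ℝ) ≤ j := Nat.cast_nonneg j
            nlinarith
        _ = ((j + 1 : ℕ) : ℝ) * (102 * ((d : ℝ) + 1) ^ 2 * L * εb) * (2 * (L : ℝ)) ^ (j + 1) * b := by push_cast; ring

end Average

end Literature.MathematicalPhysics.QuantumFieldTheory.Balaban1983to89.B8Ineq159TowerNearFlat

end
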